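import Summits.PneNP.PneNP.Theorems.ChebyshevTracialDesignWeightedSNT
import HarnessLib

/-!
# Cell pnp-psdrank, route `ChebyshevTracialDesign`, brick 66: CLASS FORCING — a homogeneous class of matchings forces its common range
# into the kernel of trace-almost-every cut operator; homogeneous ATOMS are junk-priced; homogeneous classes in general position kill the cut side

Setting of the dense non-crossing psd cell (MEMO-14 §5): a tight-orthogonal psd rectangle `(X, Y)` of dimension `r` (`X_U Y_M = 0` whenever
`cc(U,M) = 1`), the weighted spectral non-tightness (SNT-q)_w at `(τ, ε, ν)` as a hypothesis `hSNT` in the shape DISCHARGED by brick 65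
(`…WeightedSNT.weightedSNT_of_globalLevelD`, mod Keevash–Lifshitz), and a CLASS `H` of perfect matchings whose trace weight
`M ↦ tr(Y_M)/r · 1_H(M)` is `(PM_n, τ)`-homogeneous (Kupavskii–Zakharov) of mass `≥ ν·#PM_n`.
* §1 `forcing`: if a property `P` of cuts is INCOMPATIBLE with tightness against the class (`P U → X_U Y_M ≠ 0` for `M ∈ H`; e.g.
  `P U := X_U Q ≠ 0` for a matrix `Q` dominated by the class, `X_U Y_M = 0 → X_U Q = 0`), then the `t`-cuts with `P` carry trace mass
  `< ε·r·#t-cuts`. (The `r = 1` case is the emptiness of dense cells: a homogeneous-dense matching set forces the cut side to be sparse.)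
  `forcing_mulVec`: a vector `v` lying in `range Y_M` for all `M ∈ H` is killed by `X_U` for trace-almost-all `t`-cuts `U`.
* §2 `atom_value_le`: an ATOM class (`Y_M = y_M·Q` on `H`, `y_M > 0`) contributes `≤ B_v·ε·r` to the design value of ANY cut family — the
  homogeneous atom is priced at the JUNK scale `ε` (no `r = 1` rung needed), exponentially below the dictionary lemma's `γ` (brick 34);
  `atoms_value_le`: `L` homogeneous atom classes contribute `≤ L·B_v·ε·r`.
* §3 `trace_lt_of_spanning_classes`: if homogeneous classes `H_i` (`i ∈ ι`) carry vectors `v_i ∈ range Y_M` (`M ∈ H_i`) that SPAN `ℝ^r`,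
  the whole cut side has trace mass `< |ι|·ε·r·#t-cuts` — the matching-side twin of eng's general-position lemma
  (`…GeneralPositionBudget.rankOne_cut_mass_lt_of_generalPosition`): homogeneous label classes in general position are incompatible with a
  dense cut side as soon as there are `r` of them, at ANY dimension (no budget needed on this side).
* §4 `forcing_of_globalLevelD`: §1 with `hSNT` discharged by brick 65 (mod `GlobalLevelDInequality`), for the record.
[cite: KupavskiiZakharov2022, §2] [cite: KeevashLifshitz2023, Thm. 1.8] [cite: Rothvoss2017, §2 (PDF p. 6)] [cite: BrietDadushPokutta2014, Thm. 6 (§3)]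
Stature: support/instrument (kernel theorems, no defs). WHAT THIS IS NOT: not the dense cell (non-atomic, non-homogeneous label classes are
untouched), nothing on psd rank of `P_PM(K_n)`, no P-vs-NP content. Supports stmt-PneNP-19878.
-/

set_option linter.dupNamespace false -- `Summit.PneNP.PneNP.…`: summit = sub-problem (D-0017)

noncomputable section

namespace Summit.PneNP.PneNP.Theorems.ChebyshevTracialDesignClassForcing

open Finset Matrix Literature.Barriers.PneNP Literature.Combinatorics.Optimization
open Literature.Combinatorics.SetFamily
open Literature.Combinatorics.Additive.KeevashLifshitz (GlobalLevelDInequality)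
open Summit.PneNP.PneNP.Theorems.ChebyshevTracialDesignPsdCells (abs_cell_value_le_row)
open Summit.PneNP.PneNP.Theorems.ChebyshevTracialDesignAPrioriBounds (trace_le_of_sub_posSemidef)
open Summit.PneNP.PneNP.Theorems.ChebyshevTracialDesignWeightedSNT (weightedSNT_of_globalLevelD)

variable {n : ℕ}

/-! ### §1 Forcing -/

/-- **CLASS FORCING.** Let `(X, Y)` be a tight-orthogonal psd rectangle of dimension `r ≥ 1`, assume (SNT-q)_w at `(τ, ε, ν)` (hypothesis
`hSNT`, the shape of `…WeightedSNT.weightedSNT_of_globalLevelD`), and let `H` be a class of perfect matchings whose trace weight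
`tr(Y_M)/r·1_H` is `(PM_n, τ)`-homogeneous of mass `≥ ν·#PM_n`. If a property `P` of cuts is incompatible with tightness against members of
`H` (`P U → X_U Y_M ≠ 0` for all `M ∈ H`), then the `t`-cuts with `P` have trace mass `< ε·r·#t-cuts`. (Else the cut weight
`tr(X_U)/r·1_P` and the class weight have an active tight pair, whose tightness `X_U Y_M = 0` contradicts `P U`.)
[cite: KeevashLifshitz2023, Thm. 1.8] [cite: KupavskiiZakharov2022, §2] -/
theorem forcing {t r : ℕ} (hr : 0 < r) {τ ε ν : ℝ}
    (hSNT : ∀ (x : OddSet n → ℝ) (z : PMatch n → ℝ), (∀ U, 0 ≤ x U ∧ x U ≤ 1) → (∀ U, U.1.card ≠ t → x U = 0) →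
      ε * ((univ.filter fun U : OddSet n => U.1.card = t).card : ℝ) ≤ ∑ U, x U → (∀ M, 0 ≤ z M ∧ z M ≤ 1) →
      IsRelHomogeneousW τ (perfectMatchings (univ : Finset (Fin n)))
        (fun M : Finset (Sym2 (Fin n)) => if hM : IsPMOn (univ : Finset (Fin n)) M then z ⟨M, hM⟩ else 0)
        ((univ : Finset (PMatch n)).image Subtype.val) →
      ν * (Fintype.card (PMatch n) : ℝ) ≤ ∑ M, z M → ∃ U M, cc U M = 1 ∧ 0 < x U ∧ 0 < z M)
    {X : OddSet n → Matrix (Fin r) (Fin r) ℝ} {Y : PMatch n → Matrix (Fin r) (Fin r) ℝ} (hXY : IsPsdRect X Y)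
    (H : Finset (PMatch n))
    (hHhom : IsRelHomogeneousW τ (perfectMatchings (univ : Finset (Fin n)))
      (fun M : Finset (Sym2 (Fin n)) => if hM : IsPMOn (univ : Finset (Fin n)) M then
        (if (⟨M, hM⟩ : PMatch n) ∈ H then (Y ⟨M, hM⟩).trace / r else 0) else 0)
      ((univ : Finset (PMatch n)).image Subtype.val))
    (hHmass : ν * (Fintype.card (PMatch n) : ℝ) ≤ ∑ M ∈ H, (Y M).trace / r)
    (P : OddSet n → Prop) [DecidablePred P] (hP : ∀ M ∈ H, ∀ U, P U → X U * Y M ≠ 0) :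
    ∑ U ∈ univ.filter (fun U : OddSet n => U.1.card = t ∧ P U), (X U).trace <
      ε * r * ((univ.filter fun U : OddSet n => U.1.card = t).card : ℝ) := by
  classical
  have hr' : (0 : ℝ) < r := by exact_mod_cast hr
  by_contra hcon
  rw [not_lt] at hcon
  set E : Finset (OddSet n) := univ.filter (fun U : OddSet n => U.1.card = t ∧ P U) with hE
  set x : OddSet n → ℝ := fun U => if U ∈ E then (X U).trace / r else 0 with hx
  set z : PMatch n → ℝ := fun M => if M ∈ H then (Y M).trace / r else 0 with hz
  have htrX : ∀ U, 0 ≤ (X U).trace ∧ (X U).trace ≤ r := fun U =>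
    ⟨(hXY.1 U).1.trace_nonneg, trace_le_of_sub_posSemidef (hXY.1 U).2⟩
  have htrY : ∀ M, 0 ≤ (Y M).trace ∧ (Y M).trace ≤ r := fun M =>
    ⟨(hXY.2.1 M).1.trace_nonneg, trace_le_of_sub_posSemidef (hXY.2.1 M).2⟩
  have hx01 : ∀ U, 0 ≤ x U ∧ x U ≤ 1 := fun U => by
    by_cases hU : U ∈ E
    · simp only [hx, hU, if_true]
      exact ⟨div_nonneg (htrX U).1 hr'.le, (div_le_one hr').2 (htrX U).2⟩
    · simp only [hx, hU, if_false, le_refl, zero_le_one, and_self]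
  have hxt : ∀ U, U.1.card ≠ t → x U = 0 := fun U hU => by
    have : U ∉ E := fun h => hU (mem_filter.1 h).2.1
    simp only [hx, this, if_false]
  have hxm : ε * ((univ.filter fun U : OddSet n => U.1.card = t).card : ℝ) ≤ ∑ U, x U := by
    have hsum : ∑ U, x U = (∑ U ∈ E, (X U).trace) / r := by
      rw [hx, sum_div]
      rw [← sum_filter]
      simp only [filter_mem_eq_inter, univ_inter]
    rw [hsum, le_div_iff₀ hr']
    calc ε * ((univ.filter fun U : OddSet n => U.1.card = t).card : ℝ) * r
        = ε * r * ((univ.filter fun U : OddSet n => U.1.card = t).card : ℝ) := by ring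
      _ ≤ ∑ U ∈ E, (X U).trace := hcon
  have hz01 : ∀ M, 0 ≤ z M ∧ z M ≤ 1 := fun M => by
    by_cases hM : M ∈ H
    · simp only [hz, hM, if_true]
      exact ⟨div_nonneg (htrY M).1 hr'.le, (div_le_one hr').2 (htrY M).2⟩
    · simp only [hz, hM, if_false, le_refl, zero_le_one, and_self]
  have hzm : ν * (Fintype.card (PMatch n) : ℝ) ≤ ∑ M, z M := by
    have hsum : ∑ M, z M = ∑ M ∈ H, (Y M).trace / r := by
      rw [hz, ← sum_filter]
      simp only [filter_mem_eq_inter, univ_inter]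
    rw [hsum]; exact hHmass
  obtain ⟨U, M, hcc, hxU, hzM⟩ := hSNT x z hx01 hxt hxm hz01 hHhom hzm
  have hUE : U ∈ E := by by_contra h; simp only [hx, h, if_false, lt_self_iff_false] at hxU
  have hMH : M ∈ H := by by_contra h; simp only [hz, h, if_false, lt_self_iff_false] at hzM
  exact hP M hMH U (mem_filter.1 hUE).2.2 (hXY.2.2 U M hcc)

/-- Domination of a matrix by an ATOM class: if `Y_M = y_M·Q` with `y_M > 0`, tightness `X_U Y_M = 0` gives `X_U Q = 0`.
[cite: BrietDadushPokutta2014, Thm. 6 (§3)] -/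
theorem mul_eq_zero_of_atom {r : ℕ} {Z W Q : Matrix (Fin r) (Fin r) ℝ} {c : ℝ} (hc : 0 < c) (hW : W = c • Q) (h : Z * W = 0) :
    Z * Q = 0 := by
  rw [hW, Matrix.mul_smul] at h
  exact (smul_eq_zero.1 h).resolve_left hc.ne'

/-- Domination of a vector by RANGE containment: if `v = Y_M w`, tightness `X_U Y_M = 0` gives `X_U v = 0`. [cite: BrietDadushPokutta2014, Thm. 6 (§3)] -/
theorem mulVec_eq_zero_of_range {r : ℕ} {Z W : Matrix (Fin r) (Fin r) ℝ} {v w : Fin r → ℝ} (hv : W *ᵥ w = v) (h : Z * W = 0) :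
    Z *ᵥ v = 0 := by
  rw [← hv, mulVec_mulVec, h, zero_mulVec]

/-- **Forcing, vector form.** A vector `v` lying in `range Y_M` for every `M` of a homogeneous class `H` of mass `≥ ν·#PM_n` is killed by `X_U`
for all `t`-cuts `U` outside a set of trace mass `< ε·r·#t-cuts`. [cite: KeevashLifshitz2023, Thm. 1.8] [cite: KupavskiiZakharov2022, §2] -/
theorem forcing_mulVec {t r : ℕ} (hr : 0 < r) {τ ε ν : ℝ}
    (hSNT : ∀ (x : OddSet n → ℝ) (z : PMatch n → ℝ), (∀ U, 0 ≤ x U ∧ x U ≤ 1) → (∀ U, U.1.card ≠ t → x U = 0) →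
      ε * ((univ.filter fun U : OddSet n => U.1.card = t).card : ℝ) ≤ ∑ U, x U → (∀ M, 0 ≤ z M ∧ z M ≤ 1) →
      IsRelHomogeneousW τ (perfectMatchings (univ : Finset (Fin n)))
        (fun M : Finset (Sym2 (Fin n)) => if hM : IsPMOn (univ : Finset (Fin n)) M then z ⟨M, hM⟩ else 0)
        ((univ : Finset (PMatch n)).image Subtype.val) →
      ν * (Fintype.card (PMatch n) : ℝ) ≤ ∑ M, z M → ∃ U M, cc U M = 1 ∧ 0 < x U ∧ 0 < z M)
    {X : OddSet n → Matrix (Fin r) (Fin r) ℝ} {Y : PMatch n → Matrix (Fin r) (Fin r) ℝ} (hXY : IsPsdRect X Y)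
    (H : Finset (PMatch n))
    (hHhom : IsRelHomogeneousW τ (perfectMatchings (univ : Finset (Fin n)))
      (fun M : Finset (Sym2 (Fin n)) => if hM : IsPMOn (univ : Finset (Fin n)) M then
        (if (⟨M, hM⟩ : PMatch n) ∈ H then (Y ⟨M, hM⟩).trace / r else 0) else 0)
      ((univ : Finset (PMatch n)).image Subtype.val))
    (hHmass : ν * (Fintype.card (PMatch n) : ℝ) ≤ ∑ M ∈ H, (Y M).trace / r)
    (v : Fin r → ℝ) (hv : ∀ M ∈ H, ∃ w, Y M *ᵥ w = v) :
    ∑ U ∈ univ.filter (fun U : OddSet n => U.1.card = t ∧ X U *ᵥ v ≠ 0), (X U).trace <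
      ε * r * ((univ.filter fun U : OddSet n => U.1.card = t).card : ℝ) := by
  classical
  refine forcing hr hSNT hXY H hHhom hHmass (fun U => X U *ᵥ v ≠ 0) fun M hM U hPU hXYz => hPU ?_
  obtain ⟨w, hw⟩ := hv M hM
  exact mulVec_eq_zero_of_range hw hXYz

/-! ### §2 Homogeneous atoms are junk-priced -/

/-- **THE VALUE OF A HOMOGENEOUS ATOM CLASS.** Under (SNT-q)_w at `(τ, ε, ν)`: if on the class `H` the matching operators are multiples of one
matrix, `Y_M = y_M·Q` with `y_M > 0`, and the class trace weight is `(PM_n, τ)`-homogeneous of mass `≥ ν·#PM_n`, then for every cut family `A`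
and every level weight `W = levelWeight n t C w` with `Σ|w_c| ≤ B_v`:  `Σ_{U∈A} Σ_{M∈H} W(U,M)·tr(X_U Y_M) ≤ B_v·ε·r`.
(Cuts with `X_U Q = 0` contribute `0`; the others have trace mass `< ε·r·#t-cuts` by §1, priced by the row trace marginal of brick 51.)
[cite: KeevashLifshitz2023, Thm. 1.8] [cite: KupavskiiZakharov2022, §2] [cite: Rothvoss2017, §2 (PDF p. 6)] -/
theorem atom_value_le {t r : ℕ} (hr : 0 < r) {τ ε ν : ℝ} (hε : 0 ≤ ε) (C : Finset ℕ) (w : ℕ → ℝ) {Bv : ℝ}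
    (hBv : ∑ c ∈ C, |w c| ≤ Bv)
    (hSNT : ∀ (x : OddSet n → ℝ) (z : PMatch n → ℝ), (∀ U, 0 ≤ x U ∧ x U ≤ 1) → (∀ U, U.1.card ≠ t → x U = 0) →
      ε * ((univ.filter fun U : OddSet n => U.1.card = t).card : ℝ) ≤ ∑ U, x U → (∀ M, 0 ≤ z M ∧ z M ≤ 1) →
      IsRelHomogeneousW τ (perfectMatchings (univ : Finset (Fin n)))
        (fun M : Finset (Sym2 (Fin n)) => if hM : IsPMOn (univ : Finset (Fin n)) M then z ⟨M, hM⟩ else 0)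
        ((univ : Finset (PMatch n)).image Subtype.val) →
      ν * (Fintype.card (PMatch n) : ℝ) ≤ ∑ M, z M → ∃ U M, cc U M = 1 ∧ 0 < x U ∧ 0 < z M)
    {X : OddSet n → Matrix (Fin r) (Fin r) ℝ} {Y : PMatch n → Matrix (Fin r) (Fin r) ℝ} (hXY : IsPsdRect X Y)
    (H : Finset (PMatch n)) (Q : Matrix (Fin r) (Fin r) ℝ) (y : PMatch n → ℝ) (hYH : ∀ M ∈ H, Y M = y M • Q)
    (hy : ∀ M ∈ H, 0 < y M)
    (hHhom : IsRelHomogeneousW τ (perfectMatchings (univ : Finset (Fin n)))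
      (fun M : Finset (Sym2 (Fin n)) => if hM : IsPMOn (univ : Finset (Fin n)) M then
        (if (⟨M, hM⟩ : PMatch n) ∈ H then (Y ⟨M, hM⟩).trace / r else 0) else 0)
      ((univ : Finset (PMatch n)).image Subtype.val))
    (hHmass : ν * (Fintype.card (PMatch n) : ℝ) ≤ ∑ M ∈ H, (Y M).trace / r) (A : Finset (OddSet n)) :
    ∑ U ∈ A, ∑ M ∈ H, levelWeight n t C w U M * (X U * Y M).trace ≤ Bv * ε * r := by
  classical
  have hBw : 0 ≤ ∑ c ∈ C, |w c| := sum_nonneg fun c _ => abs_nonneg (w c)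
  have hBv0 : 0 ≤ Bv := hBw.trans hBv
  set N : ℝ := ((univ.filter fun U : OddSet n => U.1.card = t).card : ℝ) with hN
  -- forcing: the cuts seeing `Q` are trace-sparse
  have hforce := forcing hr hSNT hXY H hHhom hHmass (fun U => X U * Q ≠ 0)
    fun M hM U hPU hXYz => hPU (mul_eq_zero_of_atom (hy M hM) (hYH M hM) hXYz)
  -- split the cut family
  rw [← sum_filter_add_sum_filter_not A (fun U => X U * Q ≠ 0)]
  have hzero : ∑ U ∈ A.filter (fun U => ¬X U * Q ≠ 0), ∑ M ∈ H, levelWeight n t C w U M * (X U * Y M).trace = 0 := by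
    refine sum_eq_zero fun U hU => sum_eq_zero fun M hM => ?_
    have hXQ : X U * Q = 0 := not_not.1 (mem_filter.1 hU).2
    rw [hYH M hM, Matrix.mul_smul, hXQ, smul_zero, trace_zero, mul_zero]
  rw [hzero, add_zero]
  -- the exceptional cuts: row trace marginal
  have hrow := abs_cell_value_le_row (t := t) hr C w hXY (A.filter fun U => X U * Q ≠ 0) H
  have hsub : ∑ U ∈ (A.filter fun U => X U * Q ≠ 0).filter (fun U => U.1.card = t), (X U).trace ≤
      ∑ U ∈ univ.filter (fun U : OddSet n => U.1.card = t ∧ X U * Q ≠ 0), (X U).trace := by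
    refine sum_le_sum_of_subset_of_nonneg (fun U hU => ?_) fun U _ _ => (hXY.1 U).1.trace_nonneg
    simp only [mem_filter, mem_univ, true_and] at hU ⊢
    exact ⟨hU.2, hU.1.2⟩
  rcases eq_or_lt_of_le (Nat.cast_nonneg (α := ℝ) ((univ.filter fun U : OddSet n => U.1.card = t).card)) with hN0 | hNpos
  · -- no `t`-cuts: the exceptional sum is empty
    have hempty : (univ.filter fun U : OddSet n => U.1.card = t) = ∅ := by
      rw [← card_eq_zero]; exact_mod_cast hN0.symm
    have hE : (A.filter fun U => X U * Q ≠ 0).filter (fun U => U.1.card = t) = ∅ := by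
      rw [← subset_empty, ← hempty]
      intro U hU
      simp only [mem_filter, mem_univ, true_and] at hU ⊢
      exact hU.2
    rw [hE, sum_empty, zero_div, mul_zero] at hrow
    have := abs_nonpos_iff.1 hrow
    rw [this]
    have hr0 : (0 : ℝ) ≤ r := Nat.cast_nonneg r
    exact mul_nonneg (mul_nonneg hBv0 hε) hr0
  · have h1 : (∑ U ∈ (A.filter fun U => X U * Q ≠ 0).filter (fun U => U.1.card = t), (X U).trace) / N ≤ ε * r := by
      rw [div_le_iff₀ hNpos]
      exact hsub.trans hforce.le
    calc ∑ U ∈ A.filter (fun U => X U * Q ≠ 0), ∑ M ∈ H, levelWeight n t C w U M * (X U * Y M).trace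
        ≤ |∑ U ∈ A.filter (fun U => X U * Q ≠ 0), ∑ M ∈ H, levelWeight n t C w U M * (X U * Y M).trace| := le_abs_self _
      _ ≤ (∑ c ∈ C, |w c|) * ((∑ U ∈ (A.filter fun U => X U * Q ≠ 0).filter (fun U => U.1.card = t), (X U).trace) / N) := hrow
      _ ≤ Bv * (ε * r) := mul_le_mul hBv h1 (div_nonneg (sum_nonneg fun U _ => (hXY.1 U).1.trace_nonneg) hNpos.le) hBv0
      _ = Bv * ε * r := by ring

/-- **`L` homogeneous atom classes cost `≤ L·B_v·ε·r`.** Labels `ℓ : PM_n → ι` with atoms `Q_i` and scalars `y_M ≥ 0` (`Y_M = y_M·Q_{ℓ(M)}`); for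
a set `J` of labels whose classes `H_i = {M : ℓ M = i, y_M > 0}` are each `(PM_n, τ)`-homogeneous of trace mass `≥ ν·#PM_n`, the matchings with
labels in `J` contribute `≤ |J|·B_v·ε·r` to the value of any cut family. [cite: KeevashLifshitz2023, Thm. 1.8] [cite: KupavskiiZakharov2022, §2] -/
theorem atoms_value_le {t r : ℕ} (hr : 0 < r) {τ ε ν : ℝ} (hε : 0 ≤ ε) (C : Finset ℕ) (w : ℕ → ℝ) {Bv : ℝ}
    (hBv : ∑ c ∈ C, |w c| ≤ Bv)
    (hSNT : ∀ (x : OddSet n → ℝ) (z : PMatch n → ℝ), (∀ U, 0 ≤ x U ∧ x U ≤ 1) → (∀ U, U.1.card ≠ t → x U = 0) →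
      ε * ((univ.filter fun U : OddSet n => U.1.card = t).card : ℝ) ≤ ∑ U, x U → (∀ M, 0 ≤ z M ∧ z M ≤ 1) →
      IsRelHomogeneousW τ (perfectMatchings (univ : Finset (Fin n)))
        (fun M : Finset (Sym2 (Fin n)) => if hM : IsPMOn (univ : Finset (Fin n)) M then z ⟨M, hM⟩ else 0)
        ((univ : Finset (PMatch n)).image Subtype.val) →
      ν * (Fintype.card (PMatch n) : ℝ) ≤ ∑ M, z M → ∃ U M, cc U M = 1 ∧ 0 < x U ∧ 0 < z M)
    {X : OddSet n → Matrix (Fin r) (Fin r) ℝ} {Y : PMatch n → Matrix (Fin r) (Fin r) ℝ} (hXY : IsPsdRect X Y)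
    {ι : Type*} [DecidableEq ι] (ℓ : PMatch n → ι) (Q : ι → Matrix (Fin r) (Fin r) ℝ) (y : PMatch n → ℝ)
    (hY : ∀ M, Y M = y M • Q (ℓ M)) (J : Finset ι)
    (hhom : ∀ i ∈ J, IsRelHomogeneousW τ (perfectMatchings (univ : Finset (Fin n)))
      (fun M : Finset (Sym2 (Fin n)) => if hM : IsPMOn (univ : Finset (Fin n)) M then
        (if (⟨M, hM⟩ : PMatch n) ∈ univ.filter (fun M : PMatch n => ℓ M = i ∧ 0 < y M) then (Y ⟨M, hM⟩).trace / r else 0) else 0)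
      ((univ : Finset (PMatch n)).image Subtype.val))
    (hmass : ∀ i ∈ J, ν * (Fintype.card (PMatch n) : ℝ) ≤ ∑ M ∈ univ.filter (fun M : PMatch n => ℓ M = i ∧ 0 < y M), (Y M).trace / r)
    (A : Finset (OddSet n)) :
    ∑ U ∈ A, ∑ M ∈ univ.filter (fun M : PMatch n => ℓ M ∈ J ∧ 0 < y M), levelWeight n t C w U M * (X U * Y M).trace ≤
      J.card * (Bv * ε * r) := by
  classical
  -- split the matchings by label
  have hsplit : ∀ U, ∑ M ∈ univ.filter (fun M : PMatch n => ℓ M ∈ J ∧ 0 < y M), levelWeight n t C w U M * (X U * Y M).trace =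
      ∑ i ∈ J, ∑ M ∈ univ.filter (fun M : PMatch n => ℓ M = i ∧ 0 < y M), levelWeight n t C w U M * (X U * Y M).trace := by
    intro U
    have hunion : univ.filter (fun M : PMatch n => ℓ M ∈ J ∧ 0 < y M) =
        J.biUnion (fun i => univ.filter (fun M : PMatch n => ℓ M = i ∧ 0 < y M)) := by
      ext M; simp
    rw [hunion, sum_biUnion]
    intro i _ j _ hij
    simp only [Function.onFun]
    rw [disjoint_filter]
    intro M _ h1 h2
    exact hij (h1.1.symm.trans h2.1)
  simp_rw [hsplit]
  rw [sum_comm]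
  calc ∑ i ∈ J, ∑ U ∈ A, ∑ M ∈ univ.filter (fun M : PMatch n => ℓ M = i ∧ 0 < y M), levelWeight n t C w U M * (X U * Y M).trace
      ≤ ∑ _i ∈ J, Bv * ε * r := sum_le_sum fun i hi =>
        atom_value_le hr hε C w hBv hSNT hXY _ (Q i) y (fun M hM => by rw [hY M, (mem_filter.1 hM).2.1])
          (fun M hM => (mem_filter.1 hM).2.2) (hhom i hi) (hmass i hi) A
    _ = J.card * (Bv * ε * r) := by rw [sum_const, nsmul_eq_mul]

/-! ### §3 Homogeneous classes in general position kill the cut side -/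

/-- A matrix killing a spanning family of vectors is zero. [folklore] -/
theorem eq_zero_of_mulVec_span {r : ℕ} {ι : Type*} (v : ι → Fin r → ℝ) (hspan : ⊤ ≤ Submodule.span ℝ (Set.range v))
    {Z : Matrix (Fin r) (Fin r) ℝ} (hZ : ∀ i, Z *ᵥ v i = 0) : Z = 0 := by
  have hker : Submodule.span ℝ (Set.range v) ≤ LinearMap.ker Z.mulVecLin :=
    Submodule.span_le.2 (Set.range_subset_iff.2 fun i => by
      rw [SetLike.mem_coe, LinearMap.mem_ker, Matrix.mulVecLin_apply]; exact hZ i)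
  have hall : ∀ w : Fin r → ℝ, Z *ᵥ w = 0 := fun w => by
    have hw : w ∈ Submodule.span ℝ (Set.range v) :=
      hspan (show w ∈ (⊤ : Submodule ℝ (Fin r → ℝ)) from Submodule.mem_top)
    have := hker hw
    rwa [LinearMap.mem_ker, Matrix.mulVecLin_apply] at this
  have h0 : ∀ w : Fin r → ℝ, (0 : Matrix (Fin r) (Fin r) ℝ) *ᵥ w = 0 := fun w => zero_mulVec w
  exact Matrix.mulVec_injective (funext fun w => by rw [hall w, h0 w])

/-- **HOMOGENEOUS CLASSES IN GENERAL POSITION KILL THE CUT SIDE.** Under (SNT-q)_w at `(τ, ε, ν)`: if classes `H_i` (`i ∈ ι`, finite) of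
matchings with `(PM_n, τ)`-homogeneous trace weights of mass `≥ ν·#PM_n` carry vectors `v_i ∈ range Y_M` (`M ∈ H_i`) that span `ℝ^r`, then the
whole cut side has trace mass `< |ι|·ε·r·#t-cuts + (nothing)`, precisely `Σ_{|U|=t} tr X_U ≤ |ι|·ε·r·#t-cuts`: a cut outside all the
exceptional sets kills a spanning family, hence `X_U = 0`. The matching-side twin of `…GeneralPositionBudget.rankOne_cut_mass_lt_of_generalPosition`
(eng g13); no dimension budget is needed on this side. [cite: KeevashLifshitz2023, Thm. 1.8] [cite: KupavskiiZakharov2022, §2] -/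
theorem trace_le_of_spanning_classes {t r : ℕ} (hr : 0 < r) {τ ε ν : ℝ}
    (hSNT : ∀ (x : OddSet n → ℝ) (z : PMatch n → ℝ), (∀ U, 0 ≤ x U ∧ x U ≤ 1) → (∀ U, U.1.card ≠ t → x U = 0) →
      ε * ((univ.filter fun U : OddSet n => U.1.card = t).card : ℝ) ≤ ∑ U, x U → (∀ M, 0 ≤ z M ∧ z M ≤ 1) →
      IsRelHomogeneousW τ (perfectMatchings (univ : Finset (Fin n)))
        (fun M : Finset (Sym2 (Fin n)) => if hM : IsPMOn (univ : Finset (Fin n)) M then z ⟨M, hM⟩ else 0)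
        ((univ : Finset (PMatch n)).image Subtype.val) →
      ν * (Fintype.card (PMatch n) : ℝ) ≤ ∑ M, z M → ∃ U M, cc U M = 1 ∧ 0 < x U ∧ 0 < z M)
    {X : OddSet n → Matrix (Fin r) (Fin r) ℝ} {Y : PMatch n → Matrix (Fin r) (Fin r) ℝ} (hXY : IsPsdRect X Y)
    {ι : Type*} [Fintype ι] (H : ι → Finset (PMatch n)) (v : ι → Fin r → ℝ) (hspan : ⊤ ≤ Submodule.span ℝ (Set.range v))
    (hv : ∀ i, ∀ M ∈ H i, ∃ w, Y M *ᵥ w = v i)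
    (hhom : ∀ i, IsRelHomogeneousW τ (perfectMatchings (univ : Finset (Fin n)))
      (fun M : Finset (Sym2 (Fin n)) => if hM : IsPMOn (univ : Finset (Fin n)) M then
        (if (⟨M, hM⟩ : PMatch n) ∈ H i then (Y ⟨M, hM⟩).trace / r else 0) else 0)
      ((univ : Finset (PMatch n)).image Subtype.val))
    (hmass : ∀ i, ν * (Fintype.card (PMatch n) : ℝ) ≤ ∑ M ∈ H i, (Y M).trace / r) :
    ∑ U ∈ univ.filter (fun U : OddSet n => U.1.card = t), (X U).trace ≤
      Fintype.card ι * (ε * r * ((univ.filter fun U : OddSet n => U.1.card = t).card : ℝ)) := by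
  classical
  have htr0 : ∀ U, 0 ≤ (X U).trace := fun U => (hXY.1 U).1.trace_nonneg
  -- a cut killing every `v_i` is dead
  have hdead : ∀ U, (∀ i, X U *ᵥ v i = 0) → (X U).trace = 0 := fun U hU => by
    rw [eq_zero_of_mulVec_span v hspan hU, trace_zero]
  -- pointwise: tr X_U ≤ Σ_i tr X_U · [X_U v_i ≠ 0]
  have hpt : ∀ U, (X U).trace ≤ ∑ i, (if X U *ᵥ v i ≠ 0 then (X U).trace else 0) := by
    intro U
    by_cases h : ∀ i, X U *ᵥ v i = 0
    · calc (X U).trace = 0 := hdead U h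
        _ ≤ _ := sum_nonneg fun i _ => ite_nonneg (htr0 U) le_rfl
    · push Not at h
      obtain ⟨i, hi⟩ := h
      calc (X U).trace = (if X U *ᵥ v i ≠ 0 then (X U).trace else 0) := by rw [if_pos hi]
        _ ≤ ∑ i, (if X U *ᵥ v i ≠ 0 then (X U).trace else 0) :=
            single_le_sum (f := fun j => if X U *ᵥ v j ≠ 0 then (X U).trace else 0)
              (fun j _ => ite_nonneg (htr0 U) le_rfl) (mem_univ i)
  calc ∑ U ∈ univ.filter (fun U : OddSet n => U.1.card = t), (X U).trace
      ≤ ∑ U ∈ univ.filter (fun U : OddSet n => U.1.card = t), ∑ i, (if X U *ᵥ v i ≠ 0 then (X U).trace else 0) :=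
        sum_le_sum fun U _ => hpt U
    _ = ∑ i, ∑ U ∈ univ.filter (fun U : OddSet n => U.1.card = t), (if X U *ᵥ v i ≠ 0 then (X U).trace else 0) := sum_comm
    _ = ∑ i, ∑ U ∈ univ.filter (fun U : OddSet n => U.1.card = t ∧ X U *ᵥ v i ≠ 0), (X U).trace := by
        refine sum_congr rfl fun i _ => ?_
        rw [← sum_filter, filter_filter]
    _ ≤ ∑ _i : ι, ε * r * ((univ.filter fun U : OddSet n => U.1.card = t).card : ℝ) :=
        sum_le_sum fun i _ => (forcing_mulVec hr hSNT hXY (H i) (hhom i) (hmass i) (v i) (hv i)).le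
    _ = Fintype.card ι * (ε * r * ((univ.filter fun U : OddSet n => U.1.card = t).card : ℝ)) := by
        rw [sum_const, card_univ, nsmul_eq_mul]

/-! ### §4 For the record: forcing modulo Keevash–Lifshitz -/

/-- **Class forcing mod KL Thm 1.8** (§1 with (SNT-q)_w discharged by brick 65): for every `τ ≥ 2` there are `c₀ > 0`, `n₁` such that for even
`n ≥ n₁`, odd `t` with `n ≤ 5t`, `n ≤ 5(n−t)`, `ε, ν ≥ exp(−c₀·dq n)`, every tight-orthogonal psd rectangle `(X, Y)` of dimension `r ≥ 1`, every
class `H` with `(PM_n, τ)`-homogeneous trace weight of mass `≥ ν·#PM_n` and every tightness-incompatible property `P` (`P U → X_U Y_M ≠ 0` on `H`):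
the `t`-cuts with `P` carry trace mass `< ε·r·#t-cuts`. [cite: KeevashLifshitz2023, Thm. 1.8] [cite: KupavskiiZakharov2022, §2] -/
theorem forcing_of_globalLevelD (hKL : GlobalLevelDInequality) {τ : ℝ} (hτ : 2 ≤ τ) :
    ∃ c₀ : ℝ, 0 < c₀ ∧ ∃ n₁ : ℕ, ∀ (n t : ℕ), n₁ ≤ n → Even n → Odd t → n ≤ 5 * t → n ≤ 5 * (n - t) →
      ∀ (ε ν : ℝ), Real.exp (-(c₀ * dq n)) ≤ ε → Real.exp (-(c₀ * dq n)) ≤ ν →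
      ∀ (r : ℕ), 0 < r → ∀ (X : OddSet n → Matrix (Fin r) (Fin r) ℝ) (Y : PMatch n → Matrix (Fin r) (Fin r) ℝ), IsPsdRect X Y →
      ∀ (H : Finset (PMatch n)),
      IsRelHomogeneousW τ (perfectMatchings (univ : Finset (Fin n)))
        (fun M : Finset (Sym2 (Fin n)) => if hM : IsPMOn (univ : Finset (Fin n)) M then
          (if (⟨M, hM⟩ : PMatch n) ∈ H then (Y ⟨M, hM⟩).trace / r else 0) else 0)
        ((univ : Finset (PMatch n)).image Subtype.val) →
      ν * (Fintype.card (PMatch n) : ℝ) ≤ ∑ M ∈ H, (Y M).trace / r →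
      ∀ (P : OddSet n → Prop) [DecidablePred P], (∀ M ∈ H, ∀ U, P U → X U * Y M ≠ 0) →
      ∑ U ∈ univ.filter (fun U : OddSet n => U.1.card = t ∧ P U), (X U).trace <
        ε * r * ((univ.filter fun U : OddSet n => U.1.card = t).card : ℝ) := by
  obtain ⟨c₀, hc₀, n₁, hS⟩ := weightedSNT_of_globalLevelD hKL hτ
  refine ⟨c₀, hc₀, n₁, ?_⟩
  intro n t hn hev hto h5 h5' ε ν hε hν r hr X Y hXY H hHhom hHmass P _ hP
  exact forcing hr (fun x z hx hxt hxm hz hzh hzm => hS n t hn hev hto h5 h5' ε ν hε hν x z hx hxt hxm hz hzh hzm)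
    hXY H hHhom hHmass P hP

end Summit.PneNP.PneNP.Theorems.ChebyshevTracialDesignClassForcing
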